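import Literature.MathematicalPhysics.QuantumFieldTheory.Balaban1983to89.T3OneStepAveragingPlaquettes
import Literature.MathematicalPhysics.QuantumFieldTheory.Balaban1983to89.BlockAveragingEMLProp2

/-!
# `Balaban1983to89.T3Prop1EmlAtHolds` — the schema `T3LowerAlongMinimisersSplit.Prop1EmlAt` ([Balaban1985Averaging] Prop 1 (51) for the (0.4)
# averaging of [Balaban1987RG1], «asserted in print») IS A THEOREM at explicit constants

Cell `pub-ymgap` (HUMAN RULING D-0062; seat `pub-ymgap-dag-n21-c`, generation 2) — a corollary of the seat's `BlockAveragingEMLProp2` (p469485: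
[Balaban1985Averaging] Props 1–2 for the symmetric averaging (0.4) with `exp[mean log]` on `SU(N)`, PROVED) offered to the d = 3 ladder (cell `ym3-torus`,
rung R3, `UnitScaleTilt` route): its K1 child `MinimiserStabilityRegPr` (stmt-QuantumFields-19200) originally carried the hypothesis schema
`T3LowerAlongMinimisersSplit.Prop1EmlAt L C₀ c₂′` — *«[Balaban1985Averaging] PROP 1 (51) FOR THE FAMILY'S (0.4)-AVERAGING, ONE STEP, AT GIVEN CONSTANTS
(hypothesis schema, never asserted) … for (0.4) by [Balaban1987RG1] p. 253's universality sentence (cell gap G-K1a-5)»* — and struck it from `stub_lower`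
(skeleton LAYER-4 v2) by paying the crude one-step bound's price `151·B₃θ ≤ ε₀` (`T3OneStepAveragingPlaquettes`).  Here the schema itself is PROVED, for every
`L`, at `C₀ = 143·(49/4)²` and `c₂′ = 2δ₂/(7L)²` (`δ₂ = min(1/3, π/2) = 1/3`): gap G-K1a-5 is closed in kernel.

T. Bałaban, *Averaging operations for lattice gauge theories*, Commun. Math. Phys. **98** (1985) 17–51 [Balaban1985Averaging], Prop. 1 (51) p. 26;
*Renormalization group approach to lattice gauge field theories. I*, Commun. Math. Phys. **109** (1987) 249–301 [Balaban1987RG1], (0.4) p. 253.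
HONEST FRAMING: one printed estimate for the d = 3 family's averaging, by name from p469485; nothing else of Bałaban's asserted; no ladder statement
(`MinimiserStabilityRegPr`, `UnitScaleTilt`) is proved here; no count of any cell moves; one finite three-torus family at fixed `ε` — NOT continuum ∕ OS ∕
mass gap ∕ Clay.  THEOREMS ONLY (0 `def`, 0 `sorry`); new sibling module, nothing modified.
-/

noncomputable section

namespace Literature.MathematicalPhysics.QuantumFieldTheory.Balaban1983to89.T3Prop1EmlAtHolds

open Literature.MathematicalPhysics.QuantumFieldTheory.Balaban1983to89.T3ContinuumYM3Torus
open Literature.MathematicalPhysics.QuantumFieldTheory.Balaban1983to89.T3LevelShift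
open Literature.MathematicalPhysics.QuantumFieldTheory.Balaban1983to89.T3UnitLawDensityEML (ℰp)
open Literature.MathematicalPhysics.QuantumFieldTheory.Balaban1983to89.T3TiltDescent
open Literature.MathematicalPhysics.QuantumFieldTheory.Balaban1983to89.T3CruxEstimates
open Literature.MathematicalPhysics.QuantumFieldTheory.Balaban1983to89.T3LowerAlongMinimisersSplit
open Literature.MathematicalPhysics.QuantumFieldTheory.Balaban1983to89.T3OneStepAveragingPlaquettes
open Literature.MathematicalPhysics.QuantumFieldTheory.Balaban1983to89.BlockAveragingEMLProp2
open Literature.MathematicalPhysics.QuantumFieldTheory.Balaban1983to89.ExpMeanLog (deltaSU deltaSU_pos)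

/-- **ONE DESCENT STEP OF A SMALL FIELD, SHARP FORM** (d = 3, `G = SU(2)`, the family's averaging `ℰp`): `PlaqSmall a U`, `0 < a`,
`((7L)²/4)·a ≤ δ₂/2` ⇒ `PlaqSmall (L²a + 143·(((7L)²/4)·a)²) (D_{K,K+1}U)` — `BlockAveragingEMLProp2.plaqSmall_blockAvg_eml_sharp` read through
`descendTo_succ` and `plaqSmall_fieldShift`. [cite: Balaban1985Averaging, Prop. 1 (51) p.26] -/
theorem plaqSmall_descendTo_succ_sharp (F : T3Family) (K : ℕ) {a : ℝ} (ha : 0 < a)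
    {U : GaugeField (F.P (K + 1)) 0 (Matrix.specialUnitaryGroup (Fin 2) ℂ)} (hU : PlaqSmall a U)
    (hs : ((((3 + 4) * F.L : ℕ) : ℝ) ^ 2 / 4) * a ≤ deltaSU (Fin 2) / 2) :
    PlaqSmall ((F.L : ℝ) ^ 2 * a + 143 * (((((3 + 4) * F.L : ℕ) : ℝ) ^ 2 / 4) * a) ^ 2) (descendTo F ℰp K (K + 1) (Nat.le_succ K) U) := by
  rw [descendTo_succ]
  refine (plaqSmall_fieldShift F _ _ _).mpr ?_
  exact plaqSmall_blockAvg_eml_sharp (P := F.P (K + 1)) (n := Fin 2) ha hU hs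

/-- **`Prop1EmlAt` HOLDS** at `C₀ = 143·(49/4)²`, `c₂′ = 2δ₂/(7L)²`, for every `L`: the schema of `T3LowerAlongMinimisersSplit` ([Balaban1985Averaging] Prop. 1
(51) for the d = 3 family's (0.4)-averaging, one step) is a theorem — cell gap G-K1a-5 closed. [cite: Balaban1985Averaging, Prop. 1 (51) p.26] -/
theorem prop1EmlAt_holds (L : ℕ) :
    Prop1EmlAt L (143 * ((((3 + 4 : ℕ) : ℝ)) ^ 2 / 4) ^ 2) (2 * deltaSU (Fin 2) / (((3 + 4) * L : ℕ) : ℝ) ^ 2) := by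
  intro F hFL K a ha hac U hU
  subst hFL
  have hs : ((((3 + 4) * F.L : ℕ) : ℝ) ^ 2 / 4) * a ≤ deltaSU (Fin 2) / 2 :=
    smallness_of_le_c2' (P := F.P (K + 1)) (n := Fin 2) hac
  have h := plaqSmall_descendTo_succ_sharp F K ha hU hs
  have e : (F.L : ℝ) ^ 2 * a + 143 * (((((3 + 4) * F.L : ℕ) : ℝ) ^ 2 / 4) * a) ^ 2 =
      (F.L : ℝ) ^ 2 * a + (143 * ((((3 + 4 : ℕ) : ℝ)) ^ 2 / 4) ^ 2) * ((F.L : ℝ) ^ 2 * a) ^ 2 := by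
    push_cast; ring
  rw [e] at h
  exact h

/-- The constants are admissible in print's sense: `0 < C₀` and `0 < c₂′` (so `Prop1EmlAt` is consumed non-vacuously: small positive `a ≤ c₂′` exist).
[cite: Balaban1985Averaging, Prop. 1 p.26 («positive constants C₀, c′₂»)] -/
theorem prop1EmlAt_constants_pos (L : ℕ) (hL : 0 < L) :
    0 < (143 * ((((3 + 4 : ℕ) : ℝ)) ^ 2 / 4) ^ 2 : ℝ) ∧ 0 < 2 * deltaSU (Fin 2) / (((3 + 4) * L : ℕ) : ℝ) ^ 2 := by
  have hδ : 0 < deltaSU (Fin 2) := deltaSU_pos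
  refine ⟨by positivity, ?_⟩
  have : (0 : ℝ) < (((3 + 4) * L : ℕ) : ℝ) ^ 2 := by positivity
  positivity

end Literature.MathematicalPhysics.QuantumFieldTheory.Balaban1983to89.T3Prop1EmlAtHolds

end
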